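import Literature.AlgebraicGeometry.Milne1999.CMTypeNonzeroHom
import Literature.AlgebraicGeometry.HodgeTheory.MultiPowSuccCMType
import Literature.AlgebraicGeometry.Motives.AbelianVarietySimpleFactorsUnique
import HarnessLib

/-!
# `Hom(X, C) = 0 = Hom(C, X)` between an abelian variety built from simple non-CM factors and an abelian variety of CM-type

Mumford, *Abelian Varieties* (1970), §19, Thm. 1 and Cor. 1–2 (pp. 173–174), Milne 1986 §12
p. 122: every abelian variety is isogenous to a product `∏ A_i^{r_i}` of simple ones, the `A_i`
unique up to isogeny, and `Hom⁰(∏ A_i^{r_i}, ∏ B_j^{s_j})` is assembled from the `Hom⁰(A_i, B_j)`,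
which vanish unless `A_i ∼ B_j` («a non-zero homomorphism between simple abelian varieties is an
isogeny», Cor. 2).  With Milne 1999 §2 p. 54 («of CM-type» = all simple isogeny factors of CM-type)
and the isogeny invariance of CM-type this gives the orthogonality
**`Hom(X, C) = 0` and `Hom(C, X) = 0` whenever `C` is of CM-type and `X` is isogenous to a product of
simple abelian varieties NOT of CM-type** — e.g. `X ∼ E₀^{N₀+1} × ⋯ × E_r^{N_r+1}` with non-CM
elliptic curves `E_i` (the hypothesis «`Hom(A, C) = 0`» of Moonen–Zarhin, Math. Ann. 315 (1999),
§3 (3.1), between the non-CM and the CM parts).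

This file PROVES it for the tree's étale rendering `Milne1999.IsOfCMType`, over `ℂ`, from
`Milne1999/CMTypeNonzeroHom` (`Hom = 0` between a CM abelian variety and a simple non-CM one):

* §1 a small calculus of the predicate «`Hom(X, C) = 0`» (`∀ f : X ⟶ C, f = 0`): products in either
  variable (`forall_hom_from_prod_eq_zero_iff`, `forall_hom_to_prod_eq_zero_iff` — `A × B` is a
  biproduct), invariance under isogeny in either variable (`forall_hom_eq_zero_of_isIsogenous_left/right`
  — quasi-inverses `u ≫ u' = [n]`, Mumford §19 Remark p. 169, and torsion-freeness of `Hom`, Milne 1986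
  Lemma 12.2, the tree's `hom_eq_zero_of_nsmul_eq_zero`);
* §2 `forall_hom_eq_zero_of_isProductOf_not_isOfCMType` / `forall_hom_to_eq_zero_of_isProductOf_not_isOfCMType`
  — for `P` a finite product of SIMPLE NON-CM abelian varieties and `C` of CM-type, `Hom(P, C) = 0`
  and `Hom(C, P) = 0`; the same for every `X` isogenous to `P` (`…_of_isIsogenous_productOf_…`);
* §3 the products of powers `multiPowSucc r E N = E₀^{N₀+1} × ⋯ × E_r^{N_r+1}`
  (`isProductOf_powSucc`, `isProductOf_multiPowSucc`): for elliptic curves `E_i` (`dim = 1`, simple)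
  none of CM-type and `C` of CM-type, `Hom(X, C) = 0 = Hom(C, X)` for every `X ∼ ∏ E_i^{N_i+1}`
  (`forall_hom_eq_zero_of_isIsogenous_multiPowSucc_of_isOfCMType`,
  `forall_hom_to_eq_zero_of_isIsogenous_multiPowSucc_of_isOfCMType`).

No definition, no named fact: theorems only.

## References
* [MumfordAV1970] D. Mumford, *Abelian Varieties* (1970), §19 Thm. 1, Cor. 1–2 (pp. 173–174), Remark p. 169.
* [Milne1986AbelianVarieties] J. S. Milne, *Abelian Varieties* (Cornell–Silverman 1986), §12 p. 122 and Lemma 12.2.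
* [Milne1999] J. S. Milne, Compositio Math. 117 (1999), §2 p. 54.
* [MoonenZarhin1999LowDim] B. Moonen, Yu. Zarhin, Math. Ann. 315 (1999), §3 (3.1).
-/

noncomputable section

open CategoryTheory CategoryTheory.Limits

/-! ## §1 The predicate `Hom(X, C) = 0`: products and isogenies -/

namespace Literature.AlgebraicGeometry.Motives.AbelianVariety

variable {P₁ P₂ X P C : AbelianVariety ℂ}

/-- **`Hom(P₁ × P₂, C) = 0` iff `Hom(P₁, C) = 0` and `Hom(P₂, C) = 0`** (`P₁ × P₂` is the biproduct
`P₁ ⊞ P₂`, `biprodIsoProd`: a homomorphism out of it is determined by its two restrictions; Mumford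
§19 p. 173, `Hom` of a product). [cite: MumfordAV1970, §19 Thm. 1 Cor. 1–2 (pp. 173–174)] -/
theorem forall_hom_from_prod_eq_zero_iff :
    (∀ f : P₁.prod P₂ ⟶ C, f = 0) ↔ (∀ f : P₁ ⟶ C, f = 0) ∧ ∀ f : P₂ ⟶ C, f = 0 := by
  refine ⟨fun h => ⟨fun f => ?_, fun f => ?_⟩, fun h f => ?_⟩
  · rw [← Category.id_comp f, ← prodLift_fst (𝟙 P₁) (0 : P₁ ⟶ P₂), Category.assoc, h (fst P₁ P₂ ≫ f),
      comp_zero]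
  · rw [← Category.id_comp f, ← prodLift_snd (0 : P₂ ⟶ P₁) (𝟙 P₂), Category.assoc, h (snd P₁ P₂ ≫ f),
      comp_zero]
  · have hf : (biprodIsoProd P₁ P₂).hom ≫ f = 0 := by
      apply biprod.hom_ext' <;> rw [comp_zero, ← Category.assoc]
      · exact h.1 _
      · exact h.2 _
    rw [← Category.id_comp f, ← (biprodIsoProd P₁ P₂).inv_hom_id, Category.assoc, hf, comp_zero]

/-- **`Hom(C, P₁ × P₂) = 0` iff `Hom(C, P₁) = 0` and `Hom(C, P₂) = 0`** (a homomorphism into a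
product is determined by its components, `prod_hom_ext`). [cite: MumfordAV1970, §19 Thm. 1 Cor. 1–2 (pp. 173–174)] -/
theorem forall_hom_to_prod_eq_zero_iff :
    (∀ g : C ⟶ P₁.prod P₂, g = 0) ↔ (∀ g : C ⟶ P₁, g = 0) ∧ ∀ g : C ⟶ P₂, g = 0 := by
  refine ⟨fun h => ⟨fun g => ?_, fun g => ?_⟩, fun h g => ?_⟩
  · rw [← prodLift_fst g (0 : C ⟶ P₂), h (prodLift g 0), zero_comp]
  · rw [← prodLift_snd (0 : C ⟶ P₁) g, h (prodLift 0 g), zero_comp]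
  · exact prod_hom_ext (by rw [h.1 (g ≫ fst P₁ P₂), zero_comp]) (by rw [h.2 (g ≫ snd P₁ P₂), zero_comp])

/-- **`Hom(–, C) = 0` is an isogeny invariant**: if `X` is isogenous to `P` and `Hom(P, C) = 0`
then `Hom(X, C) = 0` (for `u : X → P` an isogeny with quasi-inverse `u'`, `u ≫ u' = [n]_X`,
`n • f = u ≫ (u' ≫ f) = 0`, and `Hom(X, C)` is torsion-free, Milne 1986 Lemma 12.2).
[cite: MumfordAV1970, §19 Remark p. 169] [cite: Milne1986AbelianVarieties, §12 Lemma 12.2 (PDF p. 189)] -/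
theorem forall_hom_eq_zero_of_isIsogenous_left (hXP : IsIsogenous X P) (hP : ∀ f : P ⟶ C, f = 0) :
    ∀ f : X ⟶ C, f = 0 := by
  intro f
  obtain ⟨u, hu⟩ := hXP
  obtain ⟨u', n, hn, huu', -⟩ := IsIsogeny.exists_nsmul_inverse_holds hu
  refine hom_eq_zero_of_nsmul_eq_zero hn.ne' ?_
  calc n • f = (u ≫ u') ≫ f := by rw [huu', Preadditive.nsmul_comp, Category.id_comp]
    _ = 0 := by rw [Category.assoc, hP (u' ≫ f), comp_zero]

/-- **`Hom(C, –) = 0` is an isogeny invariant**: if `X` is isogenous to `P` and `Hom(C, P) = 0`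
then `Hom(C, X) = 0` (`n • g = (g ≫ u) ≫ u' = 0`). [cite: MumfordAV1970, §19 Remark p. 169]
[cite: Milne1986AbelianVarieties, §12 Lemma 12.2 (PDF p. 189)] -/
theorem forall_hom_eq_zero_of_isIsogenous_right (hXP : IsIsogenous X P) (hP : ∀ g : C ⟶ P, g = 0) :
    ∀ g : C ⟶ X, g = 0 := by
  intro g
  obtain ⟨u, hu⟩ := hXP
  obtain ⟨u', n, hn, huu', -⟩ := IsIsogeny.exists_nsmul_inverse_holds hu
  refine hom_eq_zero_of_nsmul_eq_zero hn.ne' ?_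
  calc n • g = g ≫ (u ≫ u') := by rw [huu', Preadditive.comp_nsmul, Category.comp_id]
    _ = 0 := by rw [← Category.assoc, hP (g ≫ u), zero_comp]

/-- `Eⁿ⁺¹` is a finite product of copies of `E`: `IsProductOf Q (E.powSucc n)` as soon as `Q E`.
[cite: Milne1986AbelianVarieties, §12 p. 122 (PDF p. 189)] -/
theorem isProductOf_powSucc {Q : AbelianVariety ℂ → Prop} {E : AbelianVariety ℂ} (hE : Q E) :
    ∀ n : ℕ, IsProductOf Q (E.powSucc n)
  | 0 => .atom hE
  | n + 1 => .prod (isProductOf_powSucc hE n) (.atom hE)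

/-- `E₀^{N₀+1} × ⋯ × E_r^{N_r+1}` is a finite product of the `E_i`: `IsProductOf Q (multiPowSucc r E N)`
as soon as `Q (E i)` for all `i`. [cite: Milne1986AbelianVarieties, §12 p. 122 (PDF p. 189)] -/
theorem isProductOf_multiPowSucc {Q : AbelianVariety ℂ → Prop} :
    ∀ (r : ℕ) (E : Fin (r + 1) → AbelianVariety ℂ) (N : Fin (r + 1) → ℕ), (∀ i, Q (E i)) →
      IsProductOf Q (HodgeTheory.multiPowSucc r E N)
  | 0, _, N, hE => isProductOf_powSucc (hE 0) (N 0)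
  | r + 1, E, N, hE =>
      .prod (isProductOf_multiPowSucc r (fun i => E (Fin.castSucc i)) (fun i => N (Fin.castSucc i))
          fun i => hE (Fin.castSucc i))
        (isProductOf_powSucc (hE (Fin.last (r + 1))) (N (Fin.last (r + 1))))

end Literature.AlgebraicGeometry.Motives.AbelianVariety

/-! ## §2 Orthogonality of simple non-CM products and CM abelian varieties -/

namespace Literature.AlgebraicGeometry.Milne1999

open Literature.AlgebraicGeometry.Motives Literature.AlgebraicGeometry.Motives.AbelianVariety
open Literature.AlgebraicGeometry.HodgeTheory

variable {P X C : AbelianVariety ℂ}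

/-- **`Hom(P, C) = 0` for `P` a finite product of simple NON-CM abelian varieties and `C` of
CM-type** (induction on the product; at an atom `B`: `hom_eq_zero_of_isSimple_of_isOfCMType`, a
non-zero `B → C` would make `B` a simple isogeny factor of `C`, hence CM).
[cite: Milne1999, §2 p. 54] [cite: MumfordAV1970, §19 Thm. 1 Cor. 1–2 (pp. 173–174)] -/
theorem forall_hom_eq_zero_of_isProductOf_not_isOfCMType
    (hP : AbelianVariety.IsProductOf (fun B => AbelianVariety.IsSimple B ∧ ¬ IsOfCMType B) P)
    (hC : IsOfCMType C) : ∀ f : P ⟶ C, f = 0 := by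
  induction hP with
  | atom h => exact fun f => hom_eq_zero_of_isSimple_of_isOfCMType h.1 h.2 hC f
  | prod _ _ ih₁ ih₂ => exact forall_hom_from_prod_eq_zero_iff.2 ⟨ih₁, ih₂⟩

/-- **`Hom(C, P) = 0` for `C` of CM-type and `P` a finite product of simple NON-CM abelian
varieties** (at an atom: `hom_eq_zero_of_isOfCMType_of_isSimple`, a non-zero `C → B` is onto the
simple `B`, which would then be CM as a quotient). [cite: Milne1999, §2 p. 54]
[cite: MumfordAV1970, §19 Thm. 1 Cor. 1–2 (pp. 173–174)] -/
theorem forall_hom_to_eq_zero_of_isProductOf_not_isOfCMType (hC : IsOfCMType C)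
    (hP : AbelianVariety.IsProductOf (fun B => AbelianVariety.IsSimple B ∧ ¬ IsOfCMType B) P) :
    ∀ g : C ⟶ P, g = 0 := by
  induction hP with
  | atom h => exact fun g => hom_eq_zero_of_isOfCMType_of_isSimple hC h.1 h.2 g
  | prod _ _ ih₁ ih₂ => exact forall_hom_to_prod_eq_zero_iff.2 ⟨ih₁, ih₂⟩

/-- **`Hom(X, C) = 0` for `X` ISOGENOUS to a finite product of simple non-CM abelian varieties and
`C` of CM-type.** [cite: Milne1999, §2 p. 54] [cite: MumfordAV1970, §19 Thm. 1 Cor. 1–2 (pp. 173–174) and Remark p. 169] -/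
theorem forall_hom_eq_zero_of_isIsogenous_productOf_not_isOfCMType (hXP : AbelianVariety.IsIsogenous X P)
    (hP : AbelianVariety.IsProductOf (fun B => AbelianVariety.IsSimple B ∧ ¬ IsOfCMType B) P)
    (hC : IsOfCMType C) : ∀ f : X ⟶ C, f = 0 :=
  forall_hom_eq_zero_of_isIsogenous_left hXP (forall_hom_eq_zero_of_isProductOf_not_isOfCMType hP hC)

/-- **`Hom(C, X) = 0` for `C` of CM-type and `X` isogenous to a finite product of simple non-CM
abelian varieties.** [cite: Milne1999, §2 p. 54] [cite: MumfordAV1970, §19 Thm. 1 Cor. 1–2 (pp. 173–174) and Remark p. 169] -/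
theorem forall_hom_to_eq_zero_of_isIsogenous_productOf_not_isOfCMType (hC : IsOfCMType C)
    (hXP : AbelianVariety.IsIsogenous X P)
    (hP : AbelianVariety.IsProductOf (fun B => AbelianVariety.IsSimple B ∧ ¬ IsOfCMType B) P) :
    ∀ g : C ⟶ X, g = 0 :=
  forall_hom_eq_zero_of_isIsogenous_right hXP (forall_hom_to_eq_zero_of_isProductOf_not_isOfCMType hC hP)

/-- A finite product of simple non-CM abelian varieties with at least… — rather: such a product `P`
admits NO non-zero homomorphism to or from a CM abelian variety, so it is not isogenous to one unless
both are zero-dimensional; in particular `P` is not of CM-type as soon as `dim P > 0`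
(`𝟙 P ≠ 0`, `id_ne_zero_of_dim_pos`). [cite: Milne1999, §2 p. 54] [cite: Milne1986AbelianVarieties, §12 p. 122 (PDF p. 189)] -/
theorem not_isOfCMType_of_isProductOf_not_isOfCMType
    (hP : AbelianVariety.IsProductOf (fun B => AbelianVariety.IsSimple B ∧ ¬ IsOfCMType B) P)
    (hP0 : 0 < P.dim) : ¬ IsOfCMType P :=
  fun hC => id_ne_zero_of_dim_pos hP0 (forall_hom_eq_zero_of_isProductOf_not_isOfCMType hP hC (𝟙 P))

/-! ## §3 Products of powers of non-CM elliptic curves -/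

/-- **`Hom(X, C) = 0` for `X ∼ E₀^{N₀+1} × ⋯ × E_r^{N_r+1}` with NON-CM elliptic curves `E_i` and `C`
of CM-type** (elliptic curves are simple, `isSimple_of_dim_le_one`; the orthogonality «`Hom(A, C) = 0`»
between the non-CM elliptic part and a CM abelian variety in Moonen–Zarhin §3 (3.1)).
[cite: Milne1999, §2 p. 54] [cite: MoonenZarhin1999LowDim, §3 (3.1)]
[cite: MumfordAV1970, §19 Thm. 1 Cor. 1–2 (pp. 173–174)] -/
theorem forall_hom_eq_zero_of_isIsogenous_multiPowSucc_of_isOfCMType (r : ℕ)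
    (E : Fin (r + 1) → AbelianVariety ℂ) (N : Fin (r + 1) → ℕ) (hE : ∀ i, (E i).dim = 1)
    (hE' : ∀ i, ¬ IsOfCMType (E i)) (hX : AbelianVariety.IsIsogenous X (multiPowSucc r E N))
    (hC : IsOfCMType C) : ∀ f : X ⟶ C, f = 0 :=
  forall_hom_eq_zero_of_isIsogenous_productOf_not_isOfCMType hX
    (isProductOf_multiPowSucc r E N fun i => ⟨isSimple_of_dim_le_one (hE i).le, hE' i⟩) hC

/-- **`Hom(C, X) = 0` for `C` of CM-type and `X ∼ E₀^{N₀+1} × ⋯ × E_r^{N_r+1}` with non-CM elliptic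
curves `E_i`.** [cite: Milne1999, §2 p. 54] [cite: MoonenZarhin1999LowDim, §3 (3.1)]
[cite: MumfordAV1970, §19 Thm. 1 Cor. 1–2 (pp. 173–174)] -/
theorem forall_hom_to_eq_zero_of_isIsogenous_multiPowSucc_of_isOfCMType (r : ℕ)
    (E : Fin (r + 1) → AbelianVariety ℂ) (N : Fin (r + 1) → ℕ) (hE : ∀ i, (E i).dim = 1)
    (hE' : ∀ i, ¬ IsOfCMType (E i)) (hC : IsOfCMType C)
    (hX : AbelianVariety.IsIsogenous X (multiPowSucc r E N)) : ∀ g : C ⟶ X, g = 0 :=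
  forall_hom_to_eq_zero_of_isIsogenous_productOf_not_isOfCMType hC hX
    (isProductOf_multiPowSucc r E N fun i => ⟨isSimple_of_dim_le_one (hE i).le, hE' i⟩)

/-- The bare product: `Hom(E₀^{N₀+1} × ⋯ × E_r^{N_r+1}, C) = 0` for non-CM elliptic `E_i` and CM `C`.
[cite: Milne1999, §2 p. 54] [cite: MoonenZarhin1999LowDim, §3 (3.1)] -/
theorem forall_hom_multiPowSucc_eq_zero_of_isOfCMType (r : ℕ) (E : Fin (r + 1) → AbelianVariety ℂ)
    (N : Fin (r + 1) → ℕ) (hE : ∀ i, (E i).dim = 1) (hE' : ∀ i, ¬ IsOfCMType (E i))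
    (hC : IsOfCMType C) : ∀ f : multiPowSucc r E N ⟶ C, f = 0 :=
  forall_hom_eq_zero_of_isProductOf_not_isOfCMType
    (isProductOf_multiPowSucc r E N fun i => ⟨isSimple_of_dim_le_one (hE i).le, hE' i⟩) hC

/-- The bare product, other direction: `Hom(C, E₀^{N₀+1} × ⋯ × E_r^{N_r+1}) = 0`.
[cite: Milne1999, §2 p. 54] [cite: MoonenZarhin1999LowDim, §3 (3.1)] -/
theorem forall_hom_to_multiPowSucc_eq_zero_of_isOfCMType (r : ℕ) (E : Fin (r + 1) → AbelianVariety ℂ)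
    (N : Fin (r + 1) → ℕ) (hE : ∀ i, (E i).dim = 1) (hE' : ∀ i, ¬ IsOfCMType (E i))
    (hC : IsOfCMType C) : ∀ g : C ⟶ multiPowSucc r E N, g = 0 :=
  forall_hom_to_eq_zero_of_isProductOf_not_isOfCMType hC
    (isProductOf_multiPowSucc r E N fun i => ⟨isSimple_of_dim_le_one (hE i).le, hE' i⟩)

end Literature.AlgebraicGeometry.Milne1999
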